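import Summits.Ventures.Crystal3D.Theorems.StickyWulffConstantCoaxialWallLawInPlaneStackWalkersTwin
import HarnessLib

/-!
# `GenericWallFloor` per pair from one grain's IN-PLANE walkers as an ORIENTATION condition: charge `(√6/4)·sin θ` for every
# chain pair whose end mirror plane is tilted by `θ` with `(√3/2) sin θ ≥ 13/25`
# (crux `GenericWallFloor`, stmt-Ventures-19480, line `WallLedgerG`)

HONEST FRAMING. Venture `Summits/Ventures/Crystal3D` (cell `crystal3d-full`), helper `--supports` the crux
`GenericWallFloor` of `route-Ventures-StickyWulffConstant`, REGISTERED line `WallLedgerG`, open stub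
`stub_twoSlabAdhesion`.  Rung credit only; F-C1 not moved; NOT the crux (charge `< 1`; `ExactOnly`(C12-55) and `StarPairFar`
remain inputs BY NAME).

`genericWallFloorAtCharge_word_of_inner_ge` (`…AtHalfTilt`) needs SOME slot in the end mirror plane with `e₃`-component
`≥ 13/25`; `exists_inPlane_slot_ge_sin` (`…CoaxialWallLawInPlaneStackWalkersTwin`, the hexagon bound of `…HexSteering`)
provides one as soon as the plane is tilted enough.  Hence the one-sided word floor as a pure ORIENTATION statement:

* `genericWallFloorAtCharge_word_of_tilted_plane` — chain pair `A₂·Λ₀ = (wordFrame A₁ κ)·Λ₀`, `|κ| ≥ 2`, last letter `μ`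
  (the mirror applied first), `ν = A₁ μ`, `(√3/2)·√(1 − ⟪ν,e₃⟫²) ≥ 13/25`:
  `GenericWallFloorAtCharge ((√6/4)·√(1 − ⟪ν,e₃⟫²)) A₁ t₁ A₂ t₂` (`≥ 0.367`);
* `genericWallFloorAtCharge_wordDown_of_tilted_plane` — the mirror statement for grain 2 (`A₁·Λ₀ = (wordFrame A₂ κ)·Λ₀`).
For `Σ9` this is the word grain's composition plane tilted by `θ ≥ 36.9°`.
WHAT THIS IS NOT: not `c₀ = 1`; F-C1 not moved.
-/

noncomputable section

namespace Summit.Ventures.Crystal3D.Theorems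

open Summit.Ventures.Crystal3D Finset
open Literature.MathematicalPhysics.StatisticalMechanics (fccStacking barlowStacking IsHaggSeq)
open scoped InnerProductSpace

/-- `(√6/4)·x ≤ (√2/2)·y` whenever `(√3/2)·x ≤ y` (and `x ≥ 0`). -/
theorem sqrt6_div_four_mul_le {x y : ℝ} (h : Real.sqrt 3 / 2 * x ≤ y) :
    Real.sqrt 6 / 4 * x ≤ Real.sqrt 2 * y / 2 := by
  have h6 : Real.sqrt 6 = Real.sqrt 2 * Real.sqrt 3 := by
    rw [← Real.sqrt_mul (by norm_num : (0:ℝ) ≤ 2)]; norm_num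
  have hs2 : 0 ≤ Real.sqrt 2 := Real.sqrt_nonneg 2
  have := mul_le_mul_of_nonneg_left h hs2
  rw [h6]; nlinarith [this]

open scoped Classical in
/-- **One-sided word floor as an orientation condition (grain 1).**  Chain pair `A₂·Λ₀ = (wordFrame A₁ κ)·Λ₀` with
`|κ| ≥ 2`, last letter `μ` (first mirror), `ν = A₁ μ`; if `(√3/2)·√(1 − ⟪ν,e₃⟫²) ≥ 13/25` then
`GenericWallFloorAtCharge ((√6/4)·√(1 − ⟪ν,e₃⟫²))`, modulo `ExactOnly`(C12-55) and `StarPairFar`. -/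
theorem genericWallFloorAtCharge_word_of_tilted_plane
    {s₀ : EuclideanSpace ℝ (Fin 3)} (hs₀ : s₀ ∈ fccSlots)
    (hcert : ExactOnly 0 (fccSlots.filter fun w => 0 < ⟪w, s₀⟫_ℝ)) (hfar : StarPairFar)
    (A₁ : EuclideanSpace ℝ (Fin 3) ≃ₗᵢ[ℝ] EuclideanSpace ℝ (Fin 3)) (t₁ : EuclideanSpace ℝ (Fin 3))
    (A₂ : EuclideanSpace ℝ (Fin 3) ≃ₗᵢ[ℝ] EuclideanSpace ℝ (Fin 3)) (t₂ : EuclideanSpace ℝ (Fin 3))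
    (κ : List (EuclideanSpace ℝ (Fin 3)))
    (hκl : ∀ μ ∈ κ, ‖μ‖ = 1 ∧
      ∀ w ∈ fccSlots, ⟪w, μ⟫_ℝ = 0 ∨ ⟪w, μ⟫_ℝ = Real.sqrt (2 / 3) ∨ ⟪w, μ⟫_ℝ = -Real.sqrt (2 / 3))
    (hκc : List.IsChain (fun μ μ' => ⟪μ, μ'⟫_ℝ = 1 / 3 ∨ ⟪μ, μ'⟫_ℝ = -1 / 3) κ) (hκ2 : 2 ≤ κ.length)
    (hA₂ : A₂ '' fccStacking 1 (Real.sqrt (2 / 3)) = (wordFrame A₁ κ) '' fccStacking 1 (Real.sqrt (2 / 3)))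
    {μ : EuclideanSpace ℝ (Fin 3)} (hμ : κ.getLast? = some μ)
    (htilt : (13 / 25 : ℝ) ≤ Real.sqrt 3 / 2 *
      Real.sqrt (1 - ⟪A₁ μ, EuclideanSpace.single (2 : Fin 3) (1 : ℝ)⟫_ℝ ^ 2)) :
    GenericWallFloorAtCharge (Real.sqrt 6 / 4 *
      Real.sqrt (1 - ⟪A₁ μ, EuclideanSpace.single (2 : Fin 3) (1 : ℝ)⟫_ℝ ^ 2)) A₁ t₁ A₂ t₂ := by
  set e : EuclideanSpace ℝ (Fin 3) := EuclideanSpace.single (2 : Fin 3) (1 : ℝ) with he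
  have hμκ := hκl μ (List.mem_of_getLast? hμ)
  have hν : ‖A₁ μ‖ = 1 := by rw [LinearIsometryEquiv.norm_map, hμκ.1]
  have hmenu : ∀ w ∈ fccSlots, ⟪A₁ w, A₁ μ⟫_ℝ = 0 ∨ ⟪A₁ w, A₁ μ⟫_ℝ = Real.sqrt (2 / 3) ∨
      ⟪A₁ w, A₁ μ⟫_ℝ = -Real.sqrt (2 / 3) := fun w hw => by
    rw [LinearIsometryEquiv.inner_map_map]; exact hμκ.2 w hw
  have hlt : ⟪A₁ μ, e⟫_ℝ ^ 2 < 1 := by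
    by_contra hge
    push Not at hge
    have : Real.sqrt (1 - ⟪A₁ μ, e⟫_ℝ ^ 2) = 0 := Real.sqrt_eq_zero'.2 (by linarith)
    rw [this, mul_zero] at htilt
    norm_num at htilt
  obtain ⟨w, hw, hwν, hwe⟩ := exists_inPlane_slot_ge_sin A₁ hν hmenu hlt
  have hup : (13 / 25 : ℝ) ≤ ⟪A₁ w, e⟫_ℝ := htilt.trans hwe
  have hplane : ⟪w, μ⟫_ℝ = 0 := by rw [← LinearIsometryEquiv.inner_map_map A₁]; exact hwν
  have h := genericWallFloorAtCharge_word_of_inner_ge hs₀ hcert hfar A₁ t₁ A₂ t₂ hw hup κ hκl hκc hκ2 hA₂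
    (fun μ' hμ' => by rw [hμ] at hμ'; obtain rfl := Option.some.inj hμ'; exact hplane)
  exact genericWallFloorAtCharge_mono (sqrt6_div_four_mul_le hwe) h

open scoped Classical in
/-- **One-sided word floor as an orientation condition (grain 2).**  Chain pair presented over grain 2,
`A₁·Λ₀ = (wordFrame A₂ κ)·Λ₀`, `|κ| ≥ 2`, last letter `μ`, `ν = A₂ μ`; if `(√3/2)·√(1 − ⟪ν,e₃⟫²) ≥ 13/25` then
`GenericWallFloorAtCharge ((√6/4)·√(1 − ⟪ν,e₃⟫²))`, modulo `ExactOnly`(C12-55) and `StarPairFar`. -/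
theorem genericWallFloorAtCharge_wordDown_of_tilted_plane
    {s₀ : EuclideanSpace ℝ (Fin 3)} (hs₀ : s₀ ∈ fccSlots)
    (hcert : ExactOnly 0 (fccSlots.filter fun w => 0 < ⟪w, s₀⟫_ℝ)) (hfar : StarPairFar)
    (A₁ : EuclideanSpace ℝ (Fin 3) ≃ₗᵢ[ℝ] EuclideanSpace ℝ (Fin 3)) (t₁ : EuclideanSpace ℝ (Fin 3))
    (A₂ : EuclideanSpace ℝ (Fin 3) ≃ₗᵢ[ℝ] EuclideanSpace ℝ (Fin 3)) (t₂ : EuclideanSpace ℝ (Fin 3))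
    (κ : List (EuclideanSpace ℝ (Fin 3)))
    (hκl : ∀ μ ∈ κ, ‖μ‖ = 1 ∧
      ∀ w ∈ fccSlots, ⟪w, μ⟫_ℝ = 0 ∨ ⟪w, μ⟫_ℝ = Real.sqrt (2 / 3) ∨ ⟪w, μ⟫_ℝ = -Real.sqrt (2 / 3))
    (hκc : List.IsChain (fun μ μ' => ⟪μ, μ'⟫_ℝ = 1 / 3 ∨ ⟪μ, μ'⟫_ℝ = -1 / 3) κ) (hκ2 : 2 ≤ κ.length)
    (hA₁ : A₁ '' fccStacking 1 (Real.sqrt (2 / 3)) = (wordFrame A₂ κ) '' fccStacking 1 (Real.sqrt (2 / 3)))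
    {μ : EuclideanSpace ℝ (Fin 3)} (hμ : κ.getLast? = some μ)
    (htilt : (13 / 25 : ℝ) ≤ Real.sqrt 3 / 2 *
      Real.sqrt (1 - ⟪A₂ μ, EuclideanSpace.single (2 : Fin 3) (1 : ℝ)⟫_ℝ ^ 2)) :
    GenericWallFloorAtCharge (Real.sqrt 6 / 4 *
      Real.sqrt (1 - ⟪A₂ μ, EuclideanSpace.single (2 : Fin 3) (1 : ℝ)⟫_ℝ ^ 2)) A₁ t₁ A₂ t₂ := by
  set e : EuclideanSpace ℝ (Fin 3) := EuclideanSpace.single (2 : Fin 3) (1 : ℝ) with he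
  have hμκ := hκl μ (List.mem_of_getLast? hμ)
  have hlt : ⟪A₂ μ, e⟫_ℝ ^ 2 < 1 := by
    by_contra hge
    push Not at hge
    have : Real.sqrt (1 - ⟪A₂ μ, e⟫_ℝ ^ 2) = 0 := Real.sqrt_eq_zero'.2 (by linarith)
    rw [this, mul_zero] at htilt
    norm_num at htilt
  -- the steep in-plane slot `w` of grain 2 points up; its antipode `−w` is the down-slot we walk along
  obtain ⟨w, hw, hwν, hwe⟩ := exists_inPlane_slot_ge_sin A₂ (ν := A₂ μ) (by rw [LinearIsometryEquiv.norm_map, hμκ.1])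
    (fun w hw => by rw [LinearIsometryEquiv.inner_map_map]; exact hμκ.2 w hw) hlt
  -- `−w` is a slot, in the plane, pointing down
  have hw' : -w ∈ fccSlots := neg_mem_fccSlots hw
  have hdown : ⟪A₂ (-w), e⟫_ℝ ≤ -(13 / 25 : ℝ) := by
    rw [map_neg, inner_neg_left]; linarith [htilt.trans hwe]
  have hplane : ⟪-w, μ⟫_ℝ = 0 := by
    rw [inner_neg_left, ← LinearIsometryEquiv.inner_map_map A₂, hwν, neg_zero]
  have h := genericWallFloorAtCharge_wordDown_of_inner_le hs₀ hcert hfar A₁ t₁ A₂ t₂ hw' hdown κ hκl hκc hκ2 hA₁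
    (fun μ' hμ' => by rw [hμ] at hμ'; obtain rfl := Option.some.inj hμ'; exact hplane)
  refine genericWallFloorAtCharge_mono ?_ h
  have habs : |⟪A₂ (-w), e⟫_ℝ| = ⟪A₂ w, e⟫_ℝ := by
    rw [map_neg, inner_neg_left, abs_neg, abs_of_nonneg (by linarith [htilt.trans hwe])]
  rw [habs]
  exact sqrt6_div_four_mul_le hwe

end Summit.Ventures.Crystal3D.Theorems

end
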